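import Mathlib
import Summits.Ventures.PercRepro2.Defs
import Summits.Ventures.PercRepro2.Independence
import Summits.Ventures.PercRepro2.Harris
import Summits.Ventures.PercRepro2.ThreeEventSafe
import Summits.Ventures.PercRepro2.ThreeEventCertificate
import Summits.Ventures.PercRepro2.ThreeEventAD
import Summits.Ventures.PercRepro2.ThreeEventCertificateSections
import Summits.Ventures.PercRepro2.ThreeEventCertificateCubes
import Summits.Ventures.PercRepro2.ThreeEventAntipodal
import Summits.Ventures.PercRepro2.ThreeEventAntipodalInduction

/-!
# The bridge (FIB″) ⟹ (L): the defect as a sum of antipodal counts over the intervals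
(blind cell PercRepro2, p4 g35)

For a product weight vector `p`, `weight p ω · weight p ω' = weight p (ω ⊓ ω') · weight p (ω ⊔ ω')`
(`weight_mul_weight_eq` of ThreeEventAD: the two Bernoulli factors of an edge are those of the meet and the join).
Grouping the two-sample double sum `Ψ_p = Σ_{ω,ω'} μ(ω)μ(ω') c(ω, ω')` by the meet `w` and the join `z`
of the pair, the pairs of the fibre over `(w, z)`, `w ≤ z`, are in bijection with the configurations `σ`
of the cube over `U = {e | w e ≠ z e}` (`ω' = σ` on `U`, `ω = σ̄` on `U`, both `= w` off `U`), and the pair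
weight of `J` at such a pair is the pair weight of the restricted quadruple `J|[w,z] = restrictSec U w J`
at the antipodal pair `(σ̄, σ)`; so the fibre sum is the antipodal count `Φ(J|[w,z])`:
  `Ψ_p(J) = Σ_{w ≤ z} μ(w) μ(z) · Φ(J|[w,z])`            (`defect_eq_sum_antiCount`).
Hence `Φ ≥ 0` on every sub-cube gives `Ψ_p ≥ 0` (`defect_nonneg_of_antiCount_nonneg`), and with the
antipodal induction of ThreeEventAntipodalInduction the three-event lemma holds MODULO (∃-ANTI)
(`cov_inter_le_cov_of_antipodal_certificates`): every admissible quadruple on every nonempty finite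
cube has an edge with an antipodal-pointwise certificate ⟹ `Cov_p(M, B ∩ H) ≤ Cov_p(G, H)` for every
admissible quadruple and every admissible weight vector. Definitions `diffSet`, `baseOf`, `glueOf`
(the interval data); no instance, no notation.
-/

namespace Summit.Ventures.PercRepro2

namespace ThreeEvent

section Interval

variable {E : Type*} [Fintype E] [DecidableEq E]

/-- The edges on which two configurations differ: the free edges of the interval `[w, z]`. -/
def diffSet (w z : Config E) : Finset E := Finset.univ.filter fun e => w e ≠ z e

/-- The common value of `w` and `z` off `diffSet w z` (read on `w`). -/
def baseOf (w z : Config E) : {e // e ∉ (↑(diffSet w z) : Set E)} → Bool := fun i => w i.1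

/-- A configuration of the cube over `diffSet w z`, glued to `w` off it. -/
def glueOf (w z : Config E) (σ : Config {e // e ∈ diffSet w z}) : Config E :=
  glue (↑(diffSet w z) : Set E) (fun i : {e // e ∈ (↑(diffSet w z) : Set E)} => σ ⟨i.1, i.2⟩) (baseOf w z)

omit [DecidableEq E] in
/-- Membership in the free-edge set of `[w, z]`. -/
lemma mem_diffSet {w z : Config E} {e : E} : e ∈ diffSet w z ↔ w e ≠ z e := by
  simp [diffSet]

/-- A glued configuration on a free edge. -/
lemma glueOf_apply_of_mem (w z : Config E) (σ : Config {e // e ∈ diffSet w z}) {e : E}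
    (h : e ∈ diffSet w z) : glueOf w z σ e = σ ⟨e, h⟩ := by
  unfold glueOf
  rw [glue_apply_of_mem _ _ _ (by simpa using h)]

/-- A glued configuration off the free edges is `w`. -/
lemma glueOf_apply_of_notMem (w z : Config E) (σ : Config {e // e ∈ diffSet w z}) {e : E}
    (h : e ∉ diffSet w z) : glueOf w z σ e = w e := by
  unfold glueOf
  rw [glue_apply_of_notMem _ _ _ (by simpa using h)]
  rfl

/-- Membership of a glued configuration is membership of the section. -/
lemma glueOf_mem_iff (w z : Config E) (S : Set (Config E)) (σ : Config {e // e ∈ diffSet w z}) :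
    glueOf w z σ ∈ S ↔ σ ∈ restrictSec (diffSet w z) (baseOf w z) S := Iff.rfl

/-- The indicator of an event at a glued configuration is the indicator of the section. -/
lemma indicator_glueOf {R : Type*} [CommRing R] (w z : Config E) (S : Set (Config E))
    (σ : Config {e // e ∈ diffSet w z}) :
    S.indicator (1 : Config E → R) (glueOf w z σ)
      = (restrictSec (diffSet w z) (baseOf w z) S).indicator 1 σ := by
  by_cases h : glueOf w z σ ∈ S
  · rw [Set.indicator_of_mem h, Set.indicator_of_mem ((glueOf_mem_iff w z S σ).1 h)]
    rfl
  · rw [Set.indicator_of_notMem h, Set.indicator_of_notMem (fun h' => h ((glueOf_mem_iff w z S σ).2 h'))]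

/-- The pair weight at glued configurations is the pair weight of the restricted quadruple. -/
lemma pairWt_glueOf {R : Type*} [CommRing R] (w z : Config E) (G H M B : Set (Config E))
    (σ σ' : Config {e // e ∈ diffSet w z}) :
    (pairWt G H M B (glueOf w z σ) (glueOf w z σ') : R)
      = pairWt (restrictSec (diffSet w z) (baseOf w z) G) (restrictSec (diffSet w z) (baseOf w z) H)
          (restrictSec (diffSet w z) (baseOf w z) M) (restrictSec (diffSet w z) (baseOf w z) B) σ σ' := by
  unfold pairWt
  simp only [← restrictSec_inter, indicator_glueOf]

omit [DecidableEq E] in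
/-- On a free edge of `[w, z]` with `w ≤ z`: `w e = false` and `z e = true`. -/
lemma eq_of_mem_diffSet {w z : Config E} (hwz : w ≤ z) {e : E} (h : e ∈ diffSet w z) :
    w e = false ∧ z e = true := by
  have h1 := hwz e
  rw [mem_diffSet] at h
  revert h1 h
  cases w e <;> cases z e <;> simp

/-- The glueings of `σ̄` and `σ` have meet `w` and join `z` (`w ≤ z`). -/
lemma inf_sup_glueOf {w z : Config E} (hwz : w ≤ z) (σ : Config {e // e ∈ diffSet w z}) :
    glueOf w z (antipode σ) ⊓ glueOf w z σ = w ∧ glueOf w z (antipode σ) ⊔ glueOf w z σ = z := by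
  constructor
  · funext e
    rw [Pi.inf_apply]
    by_cases h : e ∈ diffSet w z
    · rw [glueOf_apply_of_mem w z _ h, glueOf_apply_of_mem w z _ h, (eq_of_mem_diffSet hwz h).1]
      simp [antipode]
    · rw [glueOf_apply_of_notMem w z _ h, glueOf_apply_of_notMem w z _ h]
      simp
  · funext e
    rw [Pi.sup_apply]
    by_cases h : e ∈ diffSet w z
    · rw [glueOf_apply_of_mem w z _ h, glueOf_apply_of_mem w z _ h, (eq_of_mem_diffSet hwz h).2]
      simp [antipode]
    · rw [glueOf_apply_of_notMem w z _ h, glueOf_apply_of_notMem w z _ h]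
      have : w e = z e := by
        by_contra hne
        exact h (mem_diffSet.2 hne)
      simp [this]

/-- A pair with meet `w` and join `z` is the glueing of the restriction of its H-sample. -/
lemma eq_glueOf_of_inf_sup {w z : Config E} {ω ω' : Config E} (hinf : ω ⊓ ω' = w)
    (hsup : ω ⊔ ω' = z) :
    ω = glueOf w z (antipode (restrictTo (diffSet w z) ω'))
      ∧ ω' = glueOf w z (restrictTo (diffSet w z) ω') := by
  have hi : ∀ e, (ω e && ω' e) = w e := fun e => by rw [← hinf, Pi.inf_apply]; rfl
  have hs : ∀ e, (ω e || ω' e) = z e := fun e => by rw [← hsup, Pi.sup_apply]; rfl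
  constructor
  · funext e
    by_cases h : e ∈ diffSet w z
    · rw [glueOf_apply_of_mem w z _ h]
      have h1 := hi e; have h2 := hs e
      have h3 := mem_diffSet.1 h
      simp only [antipode, restrictTo]
      revert h1 h2 h3
      cases ω e <;> cases ω' e <;> cases w e <;> cases z e <;> simp
    · rw [glueOf_apply_of_notMem w z _ h]
      have h1 := hi e; have h2 := hs e
      have h3 : w e = z e := by
        by_contra hne
        exact h (mem_diffSet.2 hne)
      revert h1 h2 h3
      cases ω e <;> cases ω' e <;> cases w e <;> cases z e <;> simp
  · funext e
    by_cases h : e ∈ diffSet w z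
    · rw [glueOf_apply_of_mem w z _ h]
      rfl
    · rw [glueOf_apply_of_notMem w z _ h]
      have h1 := hi e; have h2 := hs e
      have h3 : w e = z e := by
        by_contra hne
        exact h (mem_diffSet.2 hne)
      revert h1 h2 h3
      cases ω e <;> cases ω' e <;> cases w e <;> cases z e <;> simp

/-- Restricting a glued configuration gives back the cube configuration. -/
lemma restrictTo_glueOf (w z : Config E) (σ : Config {e // e ∈ diffSet w z}) :
    restrictTo (diffSet w z) (glueOf w z σ) = σ := by
  funext i
  simp only [restrictTo]
  rw [glueOf_apply_of_mem w z σ i.2]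

end Interval

section Fibre

variable {E : Type*} [Fintype E] [DecidableEq E] {R : Type*} [CommRing R]

/-- **The fibre sum is the antipodal count of the restricted quadruple** (`w ≤ z`): the pairs `(ω, ω')`
with `ω ⊓ ω' = w`, `ω ⊔ ω' = z` are the glueings `(σ̄, σ)`, `σ` on the cube over `diffSet w z`. -/
lemma sum_fibre_eq_antiCount (G H M B : Set (Config E)) {w z : Config E} (hwz : w ≤ z) :
    ∑ q ∈ (Finset.univ : Finset (Config E × Config E)).filter
        (fun q : Config E × Config E => (q.1 ⊓ q.2, q.1 ⊔ q.2) = (w, z)),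
      (pairWt G H M B q.1 q.2 : R)
      = antiCount (restrictSec (diffSet w z) (baseOf w z) G) (restrictSec (diffSet w z) (baseOf w z) H)
          (restrictSec (diffSet w z) (baseOf w z) M) (restrictSec (diffSet w z) (baseOf w z) B) := by
  unfold antiCount
  refine Finset.sum_nbij' (fun q => restrictTo (diffSet w z) q.2)
    (fun σ => (glueOf w z (antipode σ), glueOf w z σ)) ?_ ?_ ?_ ?_ ?_
  · intro q _
    exact Finset.mem_univ _
  · intro σ _
    simp only [Finset.mem_filter, Finset.mem_univ, true_and, Prod.mk.injEq]
    exact inf_sup_glueOf hwz σ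
  · intro q hq
    simp only [Finset.mem_filter, Finset.mem_univ, true_and, Prod.mk.injEq] at hq
    obtain ⟨h1, h2⟩ := eq_glueOf_of_inf_sup hq.1 hq.2
    exact Prod.ext h1.symm h2.symm
  · intro σ _
    exact restrictTo_glueOf w z σ
  · intro q hq
    simp only [Finset.mem_filter, Finset.mem_univ, true_and, Prod.mk.injEq] at hq
    obtain ⟨h1, h2⟩ := eq_glueOf_of_inf_sup hq.1 hq.2
    conv_lhs => rw [h1, h2]
    rw [pairWt_glueOf, restrictTo_glueOf]

/-- The fibre over `(w, z)` is empty unless `w ≤ z`. -/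
lemma sum_fibre_eq_zero (G H M B : Set (Config E)) {w z : Config E} (hwz : ¬ w ≤ z) :
    ∑ q ∈ (Finset.univ : Finset (Config E × Config E)).filter
        (fun q : Config E × Config E => (q.1 ⊓ q.2, q.1 ⊔ q.2) = (w, z)),
      (pairWt G H M B q.1 q.2 : R) = 0 := by
  refine Finset.sum_eq_zero fun q hq => ?_
  simp only [Finset.mem_filter, Finset.mem_univ, true_and, Prod.mk.injEq] at hq
  exact absurd (hq.1 ▸ hq.2 ▸ inf_le_sup) hwz

/-- **The defect as a sum of antipodal counts over the intervals**:
`Ψ_p(J) = Σ_{w ≤ z} μ(w) μ(z) · Φ(J|[w,z])`. -/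
theorem defect_eq_sum_antiCount (p : E → R) (G H M B : Set (Config E)) :
    defect p G H M B
      = ∑ w : Config E, ∑ z : Config E,
          {z' : Config E | w ≤ z'}.indicator
            (fun z => weight p w * weight p z
              * antiCount (restrictSec (diffSet w z) (baseOf w z) G)
                  (restrictSec (diffSet w z) (baseOf w z) H)
                  (restrictSec (diffSet w z) (baseOf w z) M)
                  (restrictSec (diffSet w z) (baseOf w z) B)) z := by
  rw [defect_eq_double_sum]
  have h1 : ∑ ω, ∑ ω', weight p ω * weight p ω' * pairWt G H M B ω ω'
      = ∑ q : Config E × Config E, weight p (q.1 ⊓ q.2) * weight p (q.1 ⊔ q.2)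
          * pairWt G H M B q.1 q.2 := by
    rw [Fintype.sum_prod_type]
    refine Finset.sum_congr rfl fun ω _ => Finset.sum_congr rfl fun ω' _ => ?_
    rw [weight_mul_weight_eq]
  rw [h1, ← Finset.sum_fiberwise (Finset.univ : Finset (Config E × Config E))
    (fun q : Config E × Config E => (q.1 ⊓ q.2, q.1 ⊔ q.2)), Fintype.sum_prod_type]
  refine Finset.sum_congr rfl fun w _ => Finset.sum_congr rfl fun z _ => ?_
  have h2 : ∑ q ∈ (Finset.univ : Finset (Config E × Config E)).filter
        (fun q : Config E × Config E => (q.1 ⊓ q.2, q.1 ⊔ q.2) = (w, z)),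
      weight p (q.1 ⊓ q.2) * weight p (q.1 ⊔ q.2) * pairWt G H M B q.1 q.2
      = weight p w * weight p z * ∑ q ∈ (Finset.univ : Finset (Config E × Config E)).filter
        (fun q : Config E × Config E => (q.1 ⊓ q.2, q.1 ⊔ q.2) = (w, z)),
      (pairWt G H M B q.1 q.2 : R) := by
    rw [Finset.mul_sum]
    refine Finset.sum_congr rfl fun q hq => ?_
    simp only [Finset.mem_filter, Finset.mem_univ, true_and, Prod.mk.injEq] at hq
    rw [hq.1, hq.2]
  rw [h2]
  by_cases hwz : w ≤ z
  · rw [Set.indicator_of_mem (show z ∈ {z' : Config E | w ≤ z'} from hwz),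
      sum_fibre_eq_antiCount G H M B hwz]
  · rw [Set.indicator_of_notMem (show z ∉ {z' : Config E | w ≤ z'} from hwz),
      sum_fibre_eq_zero G H M B hwz, mul_zero]

end Fibre

section Conclusion

universe u

variable {E : Type u} [Fintype E] [DecidableEq E] {R : Type*} [CommRing R] [LinearOrder R]
  [IsStrictOrderedRing R]

/-- **(FIB″) on the sub-cubes gives the three-event lemma**: if the antipodal count of the restriction
of `J` to every interval `[w, z]` is nonnegative, then `Ψ_p(J) ≥ 0` for every admissible weight vector. -/
theorem defect_nonneg_of_antiCount_nonneg {p : E → R} (hp : IsProbVec p) (G H M B : Set (Config E))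
    (hfib : ∀ w z : Config E, w ≤ z →
      (0 : R) ≤ antiCount (restrictSec (diffSet w z) (baseOf w z) G)
        (restrictSec (diffSet w z) (baseOf w z) H) (restrictSec (diffSet w z) (baseOf w z) M)
        (restrictSec (diffSet w z) (baseOf w z) B)) :
    0 ≤ defect p G H M B := by
  rw [defect_eq_sum_antiCount]
  refine Finset.sum_nonneg fun w _ => Finset.sum_nonneg fun z _ => ?_
  refine Set.indicator_nonneg (fun z hz => ?_) z
  exact mul_nonneg (mul_nonneg (weight_nonneg hp w) (weight_nonneg hp z)) (hfib w z hz)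

/-- **The three-event lemma modulo antipodal certificates (∃-ANTI)**: if on every nonempty finite cube
(of the universe of `E`) every admissible quadruple has an edge with an antipodal-pointwise certificate,
then `Cov_p(M, B ∩ H) ≤ Cov_p(G, H)` for every admissible quadruple on `E` and every admissible `p`. -/
theorem cov_inter_le_cov_of_antipodal_certificates
    (hcert : ∀ (F : Type u) [Fintype F] [DecidableEq F], Nonempty F →
      ∀ (G H M B : Set (Config F)),
        (IsUpperSet G ∧ IsUpperSet H ∧ IsUpperSet M ∧ IsLowerSet B ∧ M ⊆ G ∧ G ∩ B ⊆ M) →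
        ∃ e : F, ∃ (k : ℕ) (G₁ H₁ M₁ B₁ : Fin k → Set (Config F)) (l : Fin k → R),
          (∀ i, IsUpperSet (G₁ i) ∧ IsUpperSet (H₁ i) ∧ IsUpperSet (M₁ i) ∧ IsLowerSet (B₁ i)
            ∧ M₁ i ⊆ G₁ i ∧ G₁ i ∩ B₁ i ⊆ M₁ i) ∧ (∀ i, 0 ≤ l i) ∧
          ∀ ω : Config F, ω e = true →
            (∑ i, l i * (pairWt (G₁ i) (H₁ i) (M₁ i) (B₁ i) ω (antipodeAt e ω)
                + pairWt (G₁ i) (H₁ i) (M₁ i) (B₁ i) (antipodeAt e ω) ω))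
              ≤ (pairWt G H M B (Function.update ω e false) (antipodeAt e ω)
                  + pairWt G H M B ω (Function.update (antipodeAt e ω) e false))
                + (pairWt G H M B (Function.update (antipodeAt e ω) e false) ω
                  + pairWt G H M B (antipodeAt e ω) (Function.update ω e false)))
    {G H M B : Set (Config E)} (hG : IsUpperSet G) (hH : IsUpperSet H) (hM : IsUpperSet M)
    (hB : IsLowerSet B) (hMG : M ⊆ G) (hGB : G ∩ B ⊆ M) {p : E → R} (hp : IsProbVec p) :
    prob p (M ∩ (B ∩ H)) - prob p M * prob p (B ∩ H) ≤ prob p (G ∩ H) - prob p G * prob p H := by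
  have h := defect_nonneg_of_antiCount_nonneg hp G H M B fun w z _ =>
    antiCount_nonneg_of_antipodal_certificates hcert {e // e ∈ diffSet w z} _ _ _ _
      ⟨isUpperSet_restrictSec _ _ hG, isUpperSet_restrictSec _ _ hH, isUpperSet_restrictSec _ _ hM,
        isLowerSet_restrictSec _ _ hB, restrictSec_mono _ _ hMG,
        by rw [← restrictSec_inter]; exact restrictSec_mono _ _ hGB⟩
  unfold defect at h
  linarith

end Conclusion

end ThreeEvent

end Summit.Ventures.PercRepro2
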